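import Summits.QuantumFields.YangMills.Theorems.UV3BranchExpansionMuteJoin
import Summits.QuantumFields.YangMills.Theorems.UV3BranchExpansionCountingAmortizedFamilies
import Summits.QuantumFields.YangMills.Theorems.UV3BranchExpansionPatternReindex
import Summits.QuantumFields.YangMills.Theorems.UV3BranchExpansionCountingT3
import Summits.QuantumFields.YangMills.Theorems.UV3BranchExpansionSocketWeightsSU
import HarnessLib

/-!
# R3 (cell `ym3-torus`, YM₃ on T³ — a ladder RUNG, NOT d = 4, NOT infinite volume, NOT a mass gap, NOT the Clay problem) —
# **(F-TOP-knit) hTop FOR ONE SEGMENT OF THE STANDING RANGE: the K-fold guarded push-forward of product Haar is dominated by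
# `exp(#PBond(j+n)·γ) • dU_{j+n}` — the branch (Möbius) expansion assembled: socket ∘ (M) ∘ (M′) ∘ (C′) ∘ (A)**

Width seat `ym3-torus-px8` g13 on crux `stmt-QuantumFields-19936` `UnitScaleTilt.HistoryTailL` (`--supports`, helper; THEOREMS ONLY, 0 `def`, 0 `sorry`,
default heartbeats).  The KNIT of LEAD ★w1-19936 g12's note `Cruxes/HistoryTailL/HTopBranchExpansion.md` §6 for a segment `(j, n)`, `j + n ≤ m + K`, BY NAME over:
LEAD's socket ✓`UV3BranchExpansionGuardedTower` with `hM` discharged (px8 ✓`UV3BranchExpansionMuteJoin.map_iterFrom_le_smul_of_discoverable` — (M) px8 ∘ (M′) w2 g17 ∘ the dichotomy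
w5 g19), the ONE recursion `Dist∕X∕N` EXHIBITED (w2 ✓`UV3BranchExpansionCountingAmortizedFamilies.exists_families`), the σ-pattern adapter (w2 ✓`UV3BranchExpansionPatternReindex`),
the amortized count on the T³ tower (w5 ✓`UV3BranchExpansionCountingT3.sum_pow_card_le_exp_of_smallness_T3` over w2's (C′)), and the stacked activity (w8 g12
✓`UV3BranchExpansionSocketWeightsSU.hw_su2_of_pow_le_nine` ∕ `hw_of_fibre_law` over (A₁)–(A₃)).  RECORD CURRENCY (★★OWNER WORDS 84∕85∕89 (4)): record-independent
kinematics of product Haar under print's guarded averaging — SUPPLY for Track A's N08 `hmass` node and NODE O's use of hTop; read by no row of the χ record `AlphaInputsT3ACv4RecChi`;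
nothing of the record, of (O‴χₛ), of `HistoryTailL` or of rung R3 is proved here.

CONTENTS.
* §1 ★ `exists_traj` — the hybrid TRAJECTORY FAMILY of the socket EXHIBITED (`∃ V, hV0 ∧ hVs`; `Nat.rec` inside the proof, no definition).
* §2 ★★★ `map_iterFrom_le_exp_smul_of_hw` — ANY group, ANY small-loop average: given a geometric activity bound `hw` with ratio `W ≠ ∞` along the trajectories (w8's letter) and
  the two SMALLNESS ROWS of (C′) at `x := 2·W.toReal` (free parameters `y ∈ (0,1]`, `θ₀ < 1`; numerals only in the memo, ★★OWNER WORD 89 (5)(c)):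
  **`(dU_j).map (iterFrom (blockAvg ℰ) j n) ≤ ofReal (exp (#PBond(j+n) · (2∕(1−θ₀))·(2·W.toReal ∕ y^{(2d−1)(L−1)}))) • dU_{j+n}`**.
* §3 ★★★ `map_iterFrom_le_exp_smul_su2` — `SU(2)`, print's exp-mean-log average, `L^{d−1} ≤ 9` (the T³ families at `L = 3`): §2 ∘ §1 ∘ w8's hypothesis-free `hw` with
  `W := K⋆ · h(1∕3+δ′)^{L^{d−1}−1} ∕ h(δ′)` — NO (H_K), NO `hM`, NO count hypothesis left: only the standing range, `h(δ′) ≠ 0`, and the two smallness rows.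
hTop for `T3Family` = §3 at the unit-lattice top (`#PBond(K) = d(2L^m)^d`, K-free) — the (F-TOP-final) instantiation, not this file.

HONEST SCOPE.  Assembly by name; 0 `def`, 0 `instance`, standard axioms.  The smallness rows are HYPOTHESES on `(W, y, θ₀)` (their numerical truth at `L = d = 3`, `δ′`
optimised — px13 g13's table ∕ FILE H — is NOT asserted here).  Nothing of the χ record ∕ (O‴χₛ) ∕ `HistoryTailL` (19936) ∕ rung R3 is proved; R3 = SU(2) YM₃ on T³ — NOT d = 4,
NOT infinite volume, NOT a mass gap, NOT Clay; the YM mass gap is NOT proved.  References: T. Bałaban, Commun. Math. Phys. **109** (1987) 249–301 [Balaban1987RG1] ((0.4)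
p. 253); T. Bałaban, Commun. Math. Phys. **102** (1985) 255–275 [Balaban1985UV3] ((2) p. 256, (47)∕(55) pp. 268–269); LEAD note §6.
-/

set_option autoImplicit false

noncomputable section
open MeasureTheory Function
open scoped ENNReal

namespace Summit.QuantumFields.YangMills.Theorems.UV3BranchExpansionHTopSegment

open Literature.MathematicalPhysics.QuantumFieldTheory.Balaban1983to89
open Literature.MathematicalPhysics.QuantumFieldTheory.Balaban1983to89.AveragingRT
open Literature.MathematicalPhysics.QuantumFieldTheory.Balaban1983to89.T4Continuum (walk loopWord)
open Literature.MathematicalPhysics.QuantumFieldTheory.Balaban1983to89.BlockAveraging (Idx off Small avgFun blockAvg)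
open Literature.MathematicalPhysics.QuantumFieldTheory.Balaban1983to89.BlockAveragingHaarAC (centralBond)
open Literature.MathematicalPhysics.QuantumFieldTheory.Balaban1983to89.T4AvgSensitivity (iterFrom)
open Literature.MathematicalPhysics.QuantumFieldTheory.Balaban1983to89.ExpMeanLog (expMeanLogSU measurable_expMeanLogSU_E)
open Summit.QuantumFields.YangMills.Theorems.UV3BranchExpansionMuteJoin (map_iterFrom_le_smul_of_discoverable)
open Summit.QuantumFields.YangMills.Theorems.UV3BranchExpansionCountingAmortizedFamilies (exists_families)
open Summit.QuantumFields.YangMills.Theorems.UV3BranchExpansionPatternReindex (sum_pow_card_filter_eq')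
open Summit.QuantumFields.YangMills.Theorems.UV3BranchExpansionCountingT3 (mem_image_line_iff sum_pow_card_le_exp_of_smallness_T3)
open Summit.QuantumFields.YangMills.Theorems.UV3BranchExpansionSocketWeightsSU (hw_su2_of_pow_le_nine)
open Summit.QuantumFields.YangMills.BalabanUVNodes.N08HaarCompatibilityGuardCoreLawSU2 (mstar_pos)

variable {P : Params} {G : Type*} [GaugeGroup G] (ℰ : LoopAverage G) (j n : ℕ)

section Generic

variable [∀ k, DecidableEq (PBond P k)]

/-! ## §1 The hybrid trajectory family, exhibited -/

/-- ★ **THE TRAJECTORY FAMILY OF THE SOCKET EXISTS**: there is `V : histories → heights → fields → fields` with `V s 0 U = U` and, for `i < n`, `V s (i+1) U` = the hybrid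
step of the slice of `s` at height `i` applied to `V s i U` (`Nat.rec` inside the proof; above `n` the step is the straight transporter). [folklore] -/
theorem exists_traj : ∃ V : Finset (Σ i : Fin n, PBond P (j + i + 1)) → (i : ℕ) → GaugeField P j G → GaugeField P (j + i) G,
    (∀ s U, V s 0 U = U) ∧
    ∀ s (i : ℕ) (hi : i < n) U, V s (i + 1) U = fun c =>
      if c ∈ (Finset.univ.filter fun c' => (⟨⟨i, hi⟩, c'⟩ : Σ i : Fin n, PBond P (j + i + 1)) ∈ s) then avgFun ℰ (V s i U) c else axialAvg (V s i U) c := by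
  classical
  refine ⟨fun s => Nat.rec (motive := fun i => GaugeField P j G → GaugeField P (j + i) G) (fun U => U)
      (fun i f U => fun c => if hi : i < n then
        (if c ∈ (Finset.univ.filter fun c' => (⟨⟨i, hi⟩, c'⟩ : Σ i : Fin n, PBond P (j + i + 1)) ∈ s) then avgFun ℰ (f U) c else axialAvg (f U) c)
        else axialAvg (f U) c),
    fun s U => rfl, fun s i hi U => ?_⟩
  funext c
  show (if hi' : i < n then _ else _) = _
  rw [dif_pos hi]

/-! ## §2 The knit: any group, any small-loop average, activity ratio `W` -/

/-- ★★★ **hTop FOR A SEGMENT, MODULO THE ACTIVITY RATIO AND THE SMALLNESS ROWS.**  Standing range `j + n ≤ m + K`; a trajectory family `V` of the socket; an activity bound of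
geometric form `dU_j ((⋂_{τ∈s} Small along V s′) ∩ (V s′ n)⁻¹B) ≤ W^{|s|}·dU_{j+n}(B)` for all `s′ ⊆ s` (w8's (A)-letter), `W ≠ ∞`; and the two smallness rows of (C′) at
`x := 2·W.toReal`, `s₀ := (2d−1)(L−1)`, `r₀ := 2dL^d`, `ρ₀ := 2d` for some `y ∈ (0,1]`, `θ₀ < 1`.  Then
**`(dU_j).map (iterFrom (blockAvg ℰ) j n) ≤ ofReal (exp (#PBond(j+n)·(2∕(1−θ₀))·(x ∕ y^{s₀}))) • dU_{j+n}`**.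
PROOF: the ONE recursion by w2's `exists_families` (segments `(range L).image (line ·)`, read sets «loop words ∪ segment», `ctr := centralBond`); the socket with `hM`
discharged (px8 ✓`map_iterFrom_le_smul_of_discoverable`) at `ν := dU_{j+n}`, `w s := W^{|s|}`; the scalar `Σ_{s discoverable} 2^{|s|}W^{|s|} = Σ_{p discoverable} x^{Σ|p i|}`
(w2's adapter, `ofReal`); w5's amortized count on the tower. [cite: Balaban1987RG1, (0.4) p.253; Balaban1985UV3, (2) p.256] -/
theorem map_iterFrom_le_exp_smul_of_hw [MeasurableSpace G] [RegularGaugeGroup G] [HaarData G]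
    (hE : ∀ m, Measurable fun W : Fin (m + 1) → G => ℰ.E W)
    (V : Finset (Σ i : Fin n, PBond P (j + i + 1)) → (i : ℕ) → GaugeField P j G → GaugeField P (j + i) G)
    (hV0 : ∀ s U, V s 0 U = U)
    (hVs : ∀ s (i : ℕ) (hi : i < n) U, V s (i + 1) U = fun c =>
      if c ∈ (Finset.univ.filter fun c' => (⟨⟨i, hi⟩, c'⟩ : Σ i : Fin n, PBond P (j + i + 1)) ∈ s) then avgFun ℰ (V s i U) c else axialAvg (V s i U) c)
    (hjn : j + n ≤ P.m + P.K) {W : ℝ≥0∞} (hW : W ≠ ∞)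
    (hw : ∀ s s' : Finset (Σ i : Fin n, PBond P (j + i + 1)), s' ⊆ s → ∀ B : Set (GaugeField P (j + n) G), MeasurableSet B →
      fieldMeasure P j G ((⋂ τ ∈ s, {U : GaugeField P j G | Small ℰ (V s' τ.1 U) τ.2}) ∩ V s' n ⁻¹' B) ≤ W ^ s.card * fieldMeasure P (j + n) G B)
    {y θ₀ : ℝ} (hy : 0 < y) (hy1 : y ≤ 1) (hθ₀ : θ₀ < 1)
    (hsmallE : (1 + 2 / (1 - θ₀) * (2 * W.toReal / y ^ ((2 * P.d - 1) * (P.L - 1)))) ^ (2 * P.d * P.L ^ P.d) ≤ 2)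
    (hsmallG : (y + 2 / (1 - θ₀) * (2 * W.toReal / y ^ ((2 * P.d - 1) * (P.L - 1)))) ^ (P.L - 1) *
      (1 + 2 * (2 * W.toReal / y ^ ((2 * P.d - 1) * (P.L - 1))) / y) ^ ((P.L - 1) * (2 * P.d)) ≤ θ₀) :
    (fieldMeasure P j G).map (iterFrom (fun k => blockAvg (P := P) (j := k) ℰ) j n) ≤
      ENNReal.ofReal (Real.exp (Fintype.card (PBond P (j + n)) * (2 / (1 - θ₀) * (2 * W.toReal / y ^ ((2 * P.d - 1) * (P.L - 1)))))) •
        fieldMeasure P (j + n) G := by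
  classical
  -- the model dictionary: segments and read sets
  set lineF : (i : ℕ) → PBond P (j + i + 1) → Finset (PBond P (j + i)) := fun i g => (Finset.range P.L).image (line g) with hlF
  set Rd : (i : ℕ) → PBond P (j + i + 1) → Finset (PBond P (j + i)) := fun i c => Finset.univ.filter fun b =>
    (∃ ι : Idx P, ∃ st ∈ walk (emb c.src) (loopWord P.L c.dir (off ι.1) ι.2.1 ι.2.2), st.bond = b) ∨ ∃ t < P.L, b = line c t with hRdF
  have hlineF : ∀ i (g : PBond P (j + i + 1)) (b : PBond P (j + i)), b ∈ lineF i g ↔ ∃ t < P.L, b = line g t :=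
    fun i g b => mem_image_line_iff g b
  have hRd : ∀ i (c : PBond P (j + i + 1)) (b : PBond P (j + i)), b ∈ Rd i c →
      (∃ ι : Idx P, ∃ s ∈ walk (emb c.src) (loopWord P.L c.dir (off ι.1) ι.2.1 ι.2.2), s.bond = b) ∨ ∃ t < P.L, b = line c t :=
    fun i c b hb => (Finset.mem_filter.1 hb).2
  have hRd' : ∀ (i : ℕ) (c : PBond P (j + i + 1)) (b : PBond P (j + i)),
      (∃ (ι : Idx P), ∃ st ∈ walk (emb c.src) (loopWord P.L c.dir (off ι.1) ι.2.1 ι.2.2), st.bond = b) → b ∈ Rd i c :=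
    fun i c b h => Finset.mem_filter.2 ⟨Finset.mem_univ _, Or.inl h⟩
  have hRline : ∀ i, i < n → ∀ g : PBond P (j + i + 1), lineF i g ⊆ Rd i g :=
    fun i _ g b hb => Finset.mem_filter.2 ⟨Finset.mem_univ _, Or.inr ((hlineF i g b).1 hb)⟩
  -- the ONE recursion, exhibited
  obtain ⟨Dist, X, N, hD0, hDS, hXm, hXS, hN⟩ :=
    exists_families (β := fun i => PBond P (j + i)) (n := n) Rd lineF (fun _ g => centralBond g)
  -- the socket with `hM` discharged, at `ν := dU_{j+n}`, `w s := W^{|s|}`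
  have hmain := map_iterFrom_le_smul_of_discoverable lineF Rd Dist X N ℰ hE V hV0 hVs hjn hlineF hRd' hRline hXm hXS hDS
    (fieldMeasure P (j + n) G) (fun s => W ^ s.card) (fun s _ s' hs' B hB => hw s s' hs' B hB)
  -- the count of the discoverable patterns on the tower
  set x : ℝ := 2 * W.toReal with hx
  have hx0 : 0 ≤ x := by rw [hx]; positivity
  have hcount := sum_pow_card_le_exp_of_smallness_T3 hjn lineF hlineF Rd hRd Dist X N hD0 hDS hXm hXS hN hx0 hy hy1 hθ₀ hsmallE hsmallG
  -- the scalar: `Σ_{s discoverable} 2^{|s|} W^{|s|} ≤ ofReal (exp …)`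
  have h2W : (2 : ℝ≥0∞) * W = ENNReal.ofReal x := by
    rw [hx, ENNReal.ofReal_mul (by norm_num : (0 : ℝ) ≤ 2), ENNReal.ofReal_toReal hW, ENNReal.ofReal_ofNat]
  have hscalar : (∑ s ∈ Finset.univ.filter (fun s : Finset (Σ i : Fin n, PBond P (j + i + 1)) => ∀ i : Fin n,
        (Finset.univ.filter fun c' => (⟨i, c'⟩ : Σ i : Fin n, PBond P (j + i + 1)) ∈ s) ⊆
          X n (Dist (fun i => Finset.univ.filter fun c' => (⟨i, c'⟩ : Σ i : Fin n, PBond P (j + i + 1)) ∈ s) n)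
              (fun i => Finset.univ.filter fun c' => (⟨i, c'⟩ : Σ i : Fin n, PBond P (j + i + 1)) ∈ s) ((i : ℕ) + 1) ∪
            N i (X n (Dist (fun i => Finset.univ.filter fun c' => (⟨i, c'⟩ : Σ i : Fin n, PBond P (j + i + 1)) ∈ s) n)
                (fun i => Finset.univ.filter fun c' => (⟨i, c'⟩ : Σ i : Fin n, PBond P (j + i + 1)) ∈ s) ((i : ℕ) + 1) \
              (Finset.univ.filter fun c' => (⟨i, c'⟩ : Σ i : Fin n, PBond P (j + i + 1)) ∈ s))),
        (2 : ℝ≥0∞) ^ s.card * W ^ s.card) ≤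
      ENNReal.ofReal (Real.exp (Fintype.card (PBond P (j + n)) * (2 / (1 - θ₀) * (x / y ^ ((2 * P.d - 1) * (P.L - 1)))))) := by
    -- `2^{|s|} W^{|s|} = (ofReal x)^{|s|}`
    have hterm : ∀ s : Finset (Σ i : Fin n, PBond P (j + i + 1)), (2 : ℝ≥0∞) ^ s.card * W ^ s.card = ENNReal.ofReal x ^ s.card := by
      intro s; rw [← mul_pow, h2W]
    -- the σ-pattern adapter (w2), in `ℝ≥0∞`
    have hadapt := sum_pow_card_filter_eq'
      (fun p : (i : Fin n) → Finset (PBond P (j + i + 1)) => ∀ i : Fin n, p i ⊆ X n (Dist p n) p ((i : ℕ) + 1) ∪ N i (X n (Dist p n) p ((i : ℕ) + 1) \ p i))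
      (ENNReal.ofReal x)
    -- back to `ℝ`: w5's count
    have hfin : (∑ p ∈ (Finset.univ : Finset ((i : Fin n) → Finset (PBond P (j + i + 1)))).filter
          (fun p => ∀ i : Fin n, p i ⊆ X n (Dist p n) p ((i : ℕ) + 1) ∪ N i (X n (Dist p n) p ((i : ℕ) + 1) \ p i)),
          ENNReal.ofReal x ^ (∑ i, (p i).card)) ≤
        ENNReal.ofReal (Real.exp (Fintype.card (PBond P (j + n)) * (2 / (1 - θ₀) * (x / y ^ ((2 * P.d - 1) * (P.L - 1)))))) := by
      have hpow : ∀ p : (i : Fin n) → Finset (PBond P (j + i + 1)),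
          ENNReal.ofReal x ^ (∑ i, (p i).card) = ENNReal.ofReal (x ^ (∑ i, (p i).card)) := fun p => (ENNReal.ofReal_pow hx0 _).symm
      simp_rw [hpow]
      rw [← ENNReal.ofReal_sum_of_nonneg (fun p _ => pow_nonneg hx0 _)]
      exact ENNReal.ofReal_le_ofReal hcount
    calc _ = _ := Finset.sum_congr rfl (fun s _ => hterm s)
      _ = _ := by
          convert hadapt using 8
          all_goals rfl
      _ ≤ _ := hfin
  -- assemble
  refine Measure.le_iff.2 fun B hB => ?_
  have h1 := (Measure.le_iff.1 hmain) B hB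
  rw [Measure.smul_apply, smul_eq_mul] at h1 ⊢
  exact le_trans h1 (mul_le_mul' hscalar le_rfl)

end Generic

/-! ## §3 SU(2), print's exp-mean-log average, `L^{d−1} ≤ 9`: no hypothesis but the range, `h(δ′) ≠ 0` and the smallness rows -/
section SU2
-- NO local `DecidableEq (PBond P k)` binder here: w8's `hw_su2_of_pow_le_nine` is stated against the tree's global instance, and §1–§2 instantiate at it.

/-- ★★★ **hTop FOR A SEGMENT ON THE T³ FAMILIES (`SU(2)`, exp-mean-log average, `L^{d−1} ≤ 9`).**  Standing range `j + n ≤ m + K`; `δ′` with `h(δ′) ≠ 0`; the activity ratio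
`W := K⋆ · h(1∕3+δ′)^{L^{d−1}−1} ∕ h(δ′)` of w8's hypothesis-free ✓`hw_su2_of_pow_le_nine` (`K⋆ = m⋆⁻¹ + 1`); the two smallness rows at `x := 2·W.toReal` for some `y ∈ (0,1]`,
`θ₀ < 1`.  Then **`(dU_j).map (iterFrom (blockAvg expMeanLogSU) j n) ≤ ofReal (exp (#PBond(j+n)·(2∕(1−θ₀))·(x ∕ y^{(2d−1)(L−1)}))) • dU_{j+n}`** — the K-fold transport of product
Haar under print's guarded averaging is absolutely continuous with density `≤ e^{c}`, `c = #PBond(j+n)·γ`; at the unit-lattice top this is hTop's letter with a K-UNIFORM `c`.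
[cite: Balaban1987RG1, (0.4) p.253; Balaban1985UV3, (2) p.256] -/
theorem map_iterFrom_le_exp_smul_su2 (hjn : j + n ≤ P.m + P.K) (hL : P.L ^ (P.d - 1) ≤ 9) (δ' : ℝ)
    (hh0 : (HaarData.haar : Measure (Matrix.specialUnitaryGroup (Fin 2) ℂ)) {g | dist1 g < δ'} ≠ 0)
    {y θ₀ : ℝ} (hy : 0 < y) (hy1 : y ≤ 1) (hθ₀ : θ₀ < 1)
    (hsmallE : (1 + 2 / (1 - θ₀) * (2 *
        (((ENNReal.ofReal (((1 / 9 : ℝ) * Real.sin 1 * (Real.sin (Real.pi / 3) / (Real.pi / 3))) ^ 3 * (Real.sin (Real.pi / 3) / (Real.pi / 3)) ^ 2))⁻¹ + 1) *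
          ((HaarData.haar : Measure (Matrix.specialUnitaryGroup (Fin 2) ℂ)) {g | dist1 g < 1 / 3 + δ'} ^ (P.L ^ (P.d - 1) - 1) /
            (HaarData.haar : Measure (Matrix.specialUnitaryGroup (Fin 2) ℂ)) {g | dist1 g < δ'})).toReal /
        y ^ ((2 * P.d - 1) * (P.L - 1)))) ^ (2 * P.d * P.L ^ P.d) ≤ 2)
    (hsmallG : (y + 2 / (1 - θ₀) * (2 *
        (((ENNReal.ofReal (((1 / 9 : ℝ) * Real.sin 1 * (Real.sin (Real.pi / 3) / (Real.pi / 3))) ^ 3 * (Real.sin (Real.pi / 3) / (Real.pi / 3)) ^ 2))⁻¹ + 1) *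
          ((HaarData.haar : Measure (Matrix.specialUnitaryGroup (Fin 2) ℂ)) {g | dist1 g < 1 / 3 + δ'} ^ (P.L ^ (P.d - 1) - 1) /
            (HaarData.haar : Measure (Matrix.specialUnitaryGroup (Fin 2) ℂ)) {g | dist1 g < δ'})).toReal /
        y ^ ((2 * P.d - 1) * (P.L - 1)))) ^ (P.L - 1) *
      (1 + 2 * (2 *
        (((ENNReal.ofReal (((1 / 9 : ℝ) * Real.sin 1 * (Real.sin (Real.pi / 3) / (Real.pi / 3))) ^ 3 * (Real.sin (Real.pi / 3) / (Real.pi / 3)) ^ 2))⁻¹ + 1) *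
          ((HaarData.haar : Measure (Matrix.specialUnitaryGroup (Fin 2) ℂ)) {g | dist1 g < 1 / 3 + δ'} ^ (P.L ^ (P.d - 1) - 1) /
            (HaarData.haar : Measure (Matrix.specialUnitaryGroup (Fin 2) ℂ)) {g | dist1 g < δ'})).toReal /
        y ^ ((2 * P.d - 1) * (P.L - 1))) / y) ^ ((P.L - 1) * (2 * P.d)) ≤ θ₀) :
    (fieldMeasure P j (Matrix.specialUnitaryGroup (Fin 2) ℂ)).map
        (iterFrom (fun k => blockAvg (P := P) (j := k) (expMeanLogSU : LoopAverage (Matrix.specialUnitaryGroup (Fin 2) ℂ))) j n) ≤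
      ENNReal.ofReal (Real.exp (Fintype.card (PBond P (j + n)) * (2 / (1 - θ₀) * (2 *
        (((ENNReal.ofReal (((1 / 9 : ℝ) * Real.sin 1 * (Real.sin (Real.pi / 3) / (Real.pi / 3))) ^ 3 * (Real.sin (Real.pi / 3) / (Real.pi / 3)) ^ 2))⁻¹ + 1) *
          ((HaarData.haar : Measure (Matrix.specialUnitaryGroup (Fin 2) ℂ)) {g | dist1 g < 1 / 3 + δ'} ^ (P.L ^ (P.d - 1) - 1) /
            (HaarData.haar : Measure (Matrix.specialUnitaryGroup (Fin 2) ℂ)) {g | dist1 g < δ'})).toReal /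
        y ^ ((2 * P.d - 1) * (P.L - 1)))))) •
        fieldMeasure P (j + n) (Matrix.specialUnitaryGroup (Fin 2) ℂ) := by
  haveI := HaarData.isProb (G := Matrix.specialUnitaryGroup (Fin 2) ℂ)
  obtain ⟨V, hV0, hVs⟩ := exists_traj (P := P) (expMeanLogSU : LoopAverage (Matrix.specialUnitaryGroup (Fin 2) ℂ)) j n
  -- the activity ratio is finite: `K⋆ ≠ ∞` and the Haar-ball quotient has numerator `≤ 1`, denominator `≠ 0`
  have hKtop : (ENNReal.ofReal (((1 / 9 : ℝ) * Real.sin 1 * (Real.sin (Real.pi / 3) / (Real.pi / 3))) ^ 3 *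
      (Real.sin (Real.pi / 3) / (Real.pi / 3)) ^ 2))⁻¹ + 1 ≠ ∞ :=
    ENNReal.add_ne_top.2 ⟨ENNReal.inv_ne_top.2 (ENNReal.ofReal_pos.2 mstar_pos).ne', ENNReal.one_ne_top⟩
  have hq : (HaarData.haar : Measure (Matrix.specialUnitaryGroup (Fin 2) ℂ)) {g | dist1 g < 1 / 3 + δ'} ^ (P.L ^ (P.d - 1) - 1) /
      (HaarData.haar : Measure (Matrix.specialUnitaryGroup (Fin 2) ℂ)) {g | dist1 g < δ'} ≠ ∞ :=
    ENNReal.div_ne_top (ENNReal.pow_ne_top (measure_ne_top _ _)) hh0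
  have hW := ENNReal.mul_ne_top hKtop hq
  exact map_iterFrom_le_exp_smul_of_hw (expMeanLogSU : LoopAverage (Matrix.specialUnitaryGroup (Fin 2) ℂ)) j n measurable_expMeanLogSU_E V hV0 hVs hjn hW
    (hw_su2_of_pow_le_nine n V hV0 hVs hjn hL δ' hh0) hy hy1 hθ₀ hsmallE hsmallG

end SU2

end Summit.QuantumFields.YangMills.Theorems.UV3BranchExpansionHTopSegment

end
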